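import Mathlib
import Summits.ResolutionOfSingularities.ResolutionOfSingularities.Theorems.WeightedInvariantLocalWeightedDropCharTwoDoublePointClassKeys
import Summits.ResolutionOfSingularities.ResolutionOfSingularities.Theorems.WeightedInvariantLocalWeightedDropMonicDoublePointDescends

/-!
# `WeightedInvariant.LocalWeightedDrop`: S2 — CHAR-2 SURFACE DOUBLE POINTS ARE WON (unconditional form of the v20/v22 piece)

Crux item stmt-ResolutionOfSingularities-8899 `LocalWeightedDrop` (route `ResolutionOfSingularities/WeightedInvariant`), door
`HypersurfaceCentreConstruction` stmt-ResolutionOfSingularities-19897.  [OURS · L1 W4.3, chain w43; bookkeeping only — res-D-pv-056's corollaries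
`charTwoDoublePointSurfaceWon_of_descends` / `monicDoublePointsWon_of_descends` (…CharTwoDoublePointClassKeys, p496875) applied to the landed key
`stub_monicDoublePointDescends` (p500522).  Nothing here is a statement of any manuscript.]

* `charTwoMonicDoublePointsWon` — over every algebraically closed field of characteristic `2`, given that singular germs in `≤ 2` variables are won,
  EVERY monic double point `y² + A₁y + A₀` (`ord A₀ ≥ 3`, `ord A₁ ≥ 2`) in three variables is won in the local weighted resolution game;
* `charTwoDoublePointSurfaceWon` — the S2 piece of the engine line (statement of the v20/v22 registered stub `stub_charTwoDoublePointSurfaceWon`):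
  a singular surface germ of order `2` in characteristic `2` whose tangent cone is a square is won, given the germs of smaller order and the germs
  in fewer variables.
-/

set_option linter.dupNamespace false -- mandated namespace of this single-conjunct summit

namespace Summit.ResolutionOfSingularities.ResolutionOfSingularities.Theorems

open Literature.AlgebraicGeometry.Resolution

/-- ALL CHAR-2 MONIC DOUBLE POINTS ARE WON (OURS · L1 W4.3): `monicDoublePointsWon_of_descends stub_monicDoublePointDescends`. -/
theorem charTwoMonicDoublePointsWon :
    ∀ (k : Type) [Field k] [CharP k 2] [IsAlgClosed k],
      (∀ m : ℕ, m < 3 → ∀ g : MvPowerSeries (Fin m) k,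
        CobordantGame.IsSingular k g → CobordantGame.Won k m g) →
      ∀ (A₀ A₁ : MvPowerSeries (Fin 2) k), (2 : ℕ∞) < A₀.order → (1 : ℕ∞) < A₁.order →
        CobordantGame.Won k 3 (MvPowerSeries.X (Fin.last 2) ^ 2 +
          (MvPowerSeries.rename (Fin.succAboveEmb (Fin.last 2)) A₀ +
            MvPowerSeries.rename (Fin.succAboveEmb (Fin.last 2)) A₁ * MvPowerSeries.X (Fin.last 2))) :=
  monicDoublePointsWon_of_descends stub_monicDoublePointDescends

/-- S2 — CHAR-2 SURFACE DOUBLE POINTS WITH SQUARE TANGENT CONE ARE WON (OURS · L1 W4.3; the statement of the v20/v22 registered piece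
`stub_charTwoDoublePointSurfaceWon`, now unconditional): `charTwoDoublePointSurfaceWon_of_descends stub_monicDoublePointDescends`. -/
theorem charTwoDoublePointSurfaceWon :
    ∀ (k : Type) [Field k] [CharP k 2] [IsAlgClosed k],
      (∀ m : ℕ, m < 3 → ∀ g : MvPowerSeries (Fin m) k,
        CobordantGame.IsSingular k g → CobordantGame.Won k m g) →
      ∀ (f : MvPowerSeries (Fin 3) k), CobordantGame.IsSingular k f →
      (∀ g : MvPowerSeries (Fin 3) k, CobordantGame.IsSingular k g → g.order < f.order →
        CobordantGame.Won k 3 g) →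
      f.order = 2 →
      (∃ ℓ : Fin 3 → k, ∀ i j : Fin 3,
        MvPowerSeries.coeff (Finsupp.single i 1 + Finsupp.single j 1) f =
          MvPowerSeries.coeff (Finsupp.single i 1 + Finsupp.single j 1)
            ((∑ l, MvPowerSeries.C (ℓ l) * MvPowerSeries.X l) ^ 2)) →
      CobordantGame.Won k 3 f :=
  charTwoDoublePointSurfaceWon_of_descends stub_monicDoublePointDescends

end Summit.ResolutionOfSingularities.ResolutionOfSingularities.Theorems
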